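import Summits.BirchSwinnertonDyer.Rank1Residual.P2.CongruentNumberSilentEvenFiveThetaDescentRank
import Summits.BirchSwinnertonDyer.Rank1Residual.P2.CongruentNumberEvenFiveFamilyMonskyEven
import HarnessLib

/-!
# Cell «bsd-monsky» (prover-B): route B's `hMe` fact set on the WHOLE even-five family — Theorem B in the
# hook's `hThmB` shape for all `p ≡ 5 (mod 8)`, `q ≡ 3 (mod 4)`, and `BSD(E_{2pq}, 2)` for both symbols
# (nothing asserted)

HONEST FRAMING (cell `bsd-monsky`, run/shared/lean/pub/bsd-monsky/; README §1): glue only; every theorem is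
CONDITIONAL on the named hypotheses. `P2/CongruentNumberSilentEvenFiveThetaDescentRank.lean` proves THEOREM B with
the rank input taken from a `2`-Selmer bound (`odd_scriptL_of_thetaSpec_of_card_selmerGroup_two_le_eight`) and the
doors on `𝒮⁻` from {`thetaGenusPointDatum`, Rédei–Reichardt, `hMe`}; prover-A's
`P2/CongruentNumberEvenFiveFamilyMonskyEven.lean` supplies `#Sel₂(E_{2pq}) = 8` for EVERY `p ≡ 5 (mod 8)`,
`q ≡ 3 (mod 4)` (`card_selmerGroup_two_two_mul_five_mul_any (hMe)`, both symbols) and the `𝒮⁺` door with `hMe` in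
place of `h515`. This file composes the two:

* `theoremB_of_thetaGenusPointDatum_of_monskyEven (hΘ) (hMe)`: Theorem B in tree currency for ALL pairs — the
  hypothesis `hThmB` of the landed hook — with NEITHER the GZK binder NOR the Monsky 1990 binder (see the Rank
  file's module docstring for what "no GZK binder" does and does not mean: the displayed Thm 3.5 transcribes a
  printed statement whose proof uses the explicit Gross–Zagier formula);
* `forall_bsdp_two_congruentNumberCurve_two_mul_five_mul_of_thetaGenusPointDatum_of_monskyEven`: `BSD(E_{2pq}, 2)`
  on the whole even-five family, both symbols, from {`hTYZ`, `hGZK`, `hR`, `hMe`, `hΘ`} — GZK enters only on the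
  `(p/q) = +1` half (U⁺, the landed `𝒮⁺` theorem), `hMe` replaces `h515` everywhere.

Nothing booked; no mark moved.

References: HOME/proof/PROOF-B.md (v1.3) §8–§10; [TianYuanZhang2017] Thm. 1.2, Thm. 3.5, §1 (1.1);
[HeathBrown1994SelmerCongruentII] §1, Appendix (Monsky) p. 41; [Miller2011LMS] Def. 1.1; [LiMa2008] Thm. 0.4.
-/

noncomputable section

open scoped Classical

open WeierstrassCurve NumberField Literature.NumberTheory.EllipticCurves
  Literature.NumberTheory.EllipticCurves.Rank1Residual
  Literature.NumberTheory.EllipticCurves.Rank1Residual.Typed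
  Literature.NumberTheory.EllipticCurves.Monsky1990
  Literature.NumberTheory.EllipticCurves.HeathBrown1994
  Literature.NumberTheory.EllipticCurves.TianYuanZhang2017
  Literature.NumberTheory.QuadraticFields.RedeiReichardt

set_option autoImplicit false

namespace Summit.BirchSwinnertonDyer.Rank1Residual.P2

open ThetaDescent Conjectures

/-- **THEOREM B in tree currency from the display and `hMe`, ALL pairs** (no GZK binder, no Monsky 1990 binder):
for all primes `p ≡ 5 (mod 8)`, `q ≡ 3 (mod 4)`, `g(2pq)` odd ⟹ `∃ L` odd with `IsScriptL (2pq) L` — exactly the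
hypothesis `hThmB` of the landed hook `P2/CongruentNumberSilentEvenFiveProofBHook.lean`; the rank input of
`odd_scriptL_of_thetaSpec_of_card_selmerGroup_two_le_eight` is `#Sel₂(E_{2pq}) = 8` for every such pair
(`card_selmerGroup_two_two_mul_five_mul_any (hMe)`). CONDITIONAL on the display; nothing asserted.
[cite: TianYuanZhang2017, Thm. 3.5 and §3] [cite: HeathBrown1994SelmerCongruentII, §1 (typescript p. 1 L14–L20), Appendix (Monsky) p. 41 L20–L36] -/
theorem theoremB_of_thetaGenusPointDatum_of_monskyEven
    (hΘ : ∀ p q : ℕ, p.Prime → q.Prime → p % 8 = 5 → q % 4 = 3 → thetaGenusPointDatum p q)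
    (hMe : monsky_card_selmerGroup_two_even) :
    ∀ p q : ℕ, p.Prime → q.Prime → p % 8 = 5 → q % 4 = 3 →
      Odd (genusClassNumber (GenusField (2 * (p * q)))) → ∃ L : ℤ, Odd L ∧ IsScriptL (2 * (p * q)) L := by
  intro p q hp hq hp5 hq4 hg
  obtain ⟨D, hD, θ, hθ⟩ := hΘ p q hp hq hp5 hq4
  have hN0 : 2 * (p * q) ≠ 0 := Nat.mul_ne_zero two_ne_zero (Nat.mul_ne_zero hp.ne_zero hq.ne_zero)
  have hn1 : 1 < 2 * (p * q) := by
    have := Nat.mul_pos hp.pos hq.pos; omega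
  refine ⟨D.scriptL (2 * (p * q)), odd_scriptL_of_thetaSpec_of_card_selmerGroup_two_le_eight hp hq hp5 hq4
    D hD θ hθ hg (card_selmerGroup_two_two_mul_five_mul_any hMe hp hq hp5 hq4).le, ?_⟩
  exact hD.1 _ (Nat.mem_divisors_self _ hN0) hn1

/-- **`BSD(E_{2pq}, 2)` on the WHOLE even-five family, both symbols, with route B's kernel on `𝒮⁻` and `hMe` for
every Selmer row** (binders of the landed `𝒮⁺` theorem `hTYZ`, `hGZK`, `hR`; `hMe`; the display `hΘ`): prover-A's
`forall_bsdp_two_congruentNumberCurve_two_mul_five_mul_of_conjecture_of_monskyEven` fed with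
`congruentSilentEvenFiveBSDTwo_of_thetaGenusPointDatum_of_monskyEven`. GZK enters only on the `(p/q) = +1` half
(through U⁺); no `h515` anywhere. CONDITIONAL; nothing asserted.
[cite: TianYuanZhang2017, Thm. 1.2, Thm. 3.5 and §1 (1.1)] [cite: HeathBrown1994SelmerCongruentII, Appendix (Monsky) p. 41 L20–L36]
[cite: Miller2011LMS, Def. 1.1 (arXiv:1010.2431 p. 3)] -/
theorem forall_bsdp_two_congruentNumberCurve_two_mul_five_mul_of_thetaGenusPointDatum_of_monskyEven
    (hTYZ : tyz_genusPointData) (hGZK : rank_eq_analyticRank_of_analyticRank_le_one)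
    (hR : redeiReichardt_fourTwoCard_classGroup) (hMe : monsky_card_selmerGroup_two_even)
    (hΘ : ∀ p q : ℕ, p.Prime → q.Prime → p % 8 = 5 → q % 4 = 3 → thetaGenusPointDatum p q) :
    ∀ p q : ℕ, p.Prime → q.Prime → p % 8 = 5 → q % 4 = 3 →
      BSDp (congruentNumberCurve (2 * (p * q))) 2 :=
  forall_bsdp_two_congruentNumberCurve_two_mul_five_mul_of_conjecture_of_monskyEven hTYZ hGZK hR hMe
    (congruentSilentEvenFiveBSDTwo_of_thetaGenusPointDatum_of_monskyEven hΘ hR hMe)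

end Summit.BirchSwinnertonDyer.Rank1Residual.P2

end
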